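import Mathlib
import HarnessLib
import Summits.HubbardSuperconductivity.HubbardSuperconductivity.Theorems.KLProgrammeKLRegimeEngineTowerLevBridgeSwap

/-!
# Route `KLProgramme` — crux K3 ENGINE (stmt-HubbardSuperconductivity-20437 `KLRegimeEngineV17F2`), stub (b) v2, THE LEVELS PACKAGE (ℓ), located-risk #10
# «(ℓ)-LEV-ODD», cure (ε): the levelled-currency bridge in the PARTIAL-ASSIGNMENT (`ρ′`) currency of the oriented engine twin — `hN` / `hNsw` / `hKsw` of
# `GrassmannVertexPositionsOriented.sum_kerProdR_mul_lapWt_le_oriented` (k3c2-p3 g13, layer 1) read against the tower's `klLevNormOf` / `klTowerMeasLev`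
# (cell gate-hubbard-kl, seat hubbard-kl-k3c3-p2 g15; companion of …TowerLevBridge (k3c2-p3 g10) and …TowerLevBridgeSwap)

The oriented engine's vertex hypotheses are stated per partial sector assignment `Ωe : slots → Option Sec` («`Y` respects `Ωe`»:
`∀ i σ, Ωe i = some σ → sec (Y i) = σ`), a free slot `t` pinned at a full label `a` (`hN`, BGM level `levR Ωe + 1`) or summed over its sector (`hNsw`:
`∃ g ≥ 0`, the full-pin sums `≤ g (sec a)`, `Σ_σ g σ ≤ N (levR Ωe)`).  This IS the native currency of the tower's carrier
`klLevNormOf … Ωe = ‖W^{F_J}(T)‖` over `prescribedTuples _ Ωe` (`∀ i, ∀ s ∈ Ωe i, σ i = s`), so the model rows are immediate: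

* §1 generic label-splitting identities for a real size function `Φ σ x` on `P × S` (full pin / position-only pin, with the «respects» guard);
  `levelCount_update_none` (`levelCount (Ωe[q ↦ none]) + 1 = levelCount Ωe` for a prescribed `q`);
* §2 MODEL, `(σ, x)` currency, conserving `T` at family `F_J`: **`respects_fullPin_le_klLevNormOf`** (`ε^m Σ_{σ : σ t = s₀, σ ⊒ Ωe} Σ_{x_t = y} ‖W_σ(x)‖ ≤ klLevNormOf … Ωe`,
  ANY `t`), **`respects_posPin_le_klLevNormOf_update`** (position-only pin at ANY `t`, `Ωe q = some s_q` ⇒ `≤ klLevNormOf … (Ωe[q ↦ none])` — ONE LEVEL LOWER, by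
  translation invariance `…BridgeSwap`/`sum_filter_apply_eq_of_translate`), `respects_posPin_le_card_mul_klLevNormOf` (crude: `≤ |Sec|·klLevNormOf … Ωe`, any `Ωe`);
  tower instances `…_klTowerInput_le_klTowerMeasLev` (levels `levelCount Ωe`, `levelCount Ωe − 1`, `|Sec|·(levelCount Ωe)`);
* §3 MODEL, `Γ`-tuple currency over `K = kernel (sectorPreimage β F_{dk−1} 𝒱_{dk}) (m+1)` — the LITERAL layer-1 shapes: **`hN_respects_klTowerInput`**
  (`Σ_{Y : Y t = a} (if Y ⊒ Ωe then ‖K Y‖ else 0) ≤ ε_x·klTowerMeasLev … (levelCount Ωe)`), **`hNsw_respects_klTowerInput`** (`Ωe q = some _` ⇒ `∃ g ≥ 0`, full pins `≤ g a.2`,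
  `Σ_σ g σ ≤ ε_x·klTowerMeasLev … (levelCount Ωe − 1)`), **`hNsw_respects_klTowerInput_card`** (any `Ωe`: `Σ_σ g σ ≤ |SectorLeg|·ε_x·klTowerMeasLev … (levelCount Ωe)`).
So the instantiation sets `Nv u (F+1) := ε_x·klTowerMeasLev … F` and `Nv u 0 := |SectorLeg (sectorCount (dk−1))|·ε_x·klTowerMeasLev … 0`.
Proofs only (compositions of landed lemmas); nothing about the model is asserted; nothing asserts (ℓ), any stub, K3 or superconductivity.
References: BGM 2006 §2.8 (2.76), (2.88)–(2.90), (2.97)–(2.98), App. A4 (A4.8) [cite: BenfattoGiulianiMastropietro2006].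
-/

noncomputable section

namespace Summit.HubbardSuperconductivity.HubbardSuperconductivity.Theorems.EngineV8

set_option linter.dupNamespace false -- summit = problem name (single-conjunct summit), D-0017

open Classical
open Real Finset Literature.MathematicalPhysics.QuantumLattice Literature.Probability.LatticeModels GrassmannAlgebra
open Literature.MathematicalPhysics.QuantumLattice.FermiRG
open Summit.HubbardSuperconductivity.HubbardSuperconductivity.Theorems.KLRegimeSplit
open Summit.HubbardSuperconductivity.HubbardSuperconductivity.Theorems.KLProgrammeLegKernels
open Summit.HubbardSuperconductivity.HubbardSuperconductivity.Theorems.DispersionFlow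
open Summit.HubbardSuperconductivity.HubbardSuperconductivity.Theorems.KLRegimeWick

/-! ## §1 Generic identities in the `ρ′` currency -/

section Generic

variable {S P : Type*} [Fintype S] [DecidableEq S] [Fintype P] [DecidableEq P]

omit [DecidableEq S] [DecidableEq P] in
/-- Splitting a sum over tuples of (position, label) pairs into the label tuples and the position tuples. -/
private theorem sum_tuple_prod_eq_sum_sum_rho {α : Type*} [AddCommMonoid α] (n : ℕ)
    (g : (Fin n → P × S) → α) : ∑ Y, g Y = ∑ σ : Fin n → S, ∑ x : Fin n → P, g (fun i => (x i, σ i)) := by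
  rw [← (Equiv.arrowProdEquivProdArrow (Fin n) (fun _ => P) (fun _ => S)).symm.sum_comp, Fintype.sum_prod_type, sum_comm]
  rfl

/-- **Full pin, `ρ′` currency**: `Σ_{Y : Y t = a} (if Y ⊒ Ωe then Φ(sec∘Y, pos∘Y) else 0) = Σ_{σ : σ t = a.2 ∧ σ ⊒ Ωe} Σ_{x : x t = a.1} Φ σ x`. -/
theorem sum_ite_respects_fullPin_eq {n : ℕ} (Φ : (Fin n → S) → (Fin n → P) → ℝ) (Ωe : Fin n → Option S) (t : Fin n) (a : P × S) :
    ∑ Y ∈ univ.filter (fun Y : Fin n → P × S => Y t = a),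
        (if ∀ (i : Fin n) (s : S), Ωe i = some s → (Y i).2 = s then Φ (fun i => (Y i).2) (fun i => (Y i).1) else 0) =
      ∑ σ ∈ univ.filter (fun σ : Fin n → S => σ t = a.2 ∧ ∀ (i : Fin n) (s : S), Ωe i = some s → σ i = s),
        ∑ x ∈ univ.filter (fun x : Fin n → P => x t = a.1), Φ σ x := by
  rw [sum_filter, sum_tuple_prod_eq_sum_sum_rho n, sum_filter]
  refine sum_congr rfl fun σ _ => ?_
  by_cases hσ : σ t = a.2 ∧ ∀ (i : Fin n) (s : S), Ωe i = some s → σ i = s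
  · simp only [if_pos hσ, if_pos hσ.2, sum_filter]
    refine sum_congr rfl fun x _ => ?_
    simp only [Prod.ext_iff, hσ.1, and_true]
  · rw [if_neg hσ]
    refine sum_eq_zero fun x _ => ?_
    by_cases hx : (fun i => (x i, σ i)) t = a
    · have hσt : σ t = a.2 := (Prod.ext_iff.1 hx).2
      have hnot : ¬ ∀ (i : Fin n) (s : S), Ωe i = some s → σ i = s := fun h => hσ ⟨hσt, h⟩
      rw [if_pos hx, if_neg hnot]
    · rw [if_neg hx]

/-- **Position-only pin, `ρ′` currency**: `Σ_{Y : (Y t).1 = y} (if Y ⊒ Ωe then Φ(sec∘Y, pos∘Y) else 0) = Σ_{σ ⊒ Ωe} Σ_{x : x t = y} Φ σ x`. -/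
theorem sum_ite_respects_posPin_eq {n : ℕ} (Φ : (Fin n → S) → (Fin n → P) → ℝ) (Ωe : Fin n → Option S) (t : Fin n) (y : P) :
    ∑ Y ∈ univ.filter (fun Y : Fin n → P × S => (Y t).1 = y),
        (if ∀ (i : Fin n) (s : S), Ωe i = some s → (Y i).2 = s then Φ (fun i => (Y i).2) (fun i => (Y i).1) else 0) =
      ∑ σ ∈ univ.filter (fun σ : Fin n → S => ∀ (i : Fin n) (s : S), Ωe i = some s → σ i = s),
        ∑ x ∈ univ.filter (fun x : Fin n → P => x t = y), Φ σ x := by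
  rw [sum_filter, sum_tuple_prod_eq_sum_sum_rho n, sum_filter]
  refine sum_congr rfl fun σ _ => ?_
  by_cases hσ : ∀ (i : Fin n) (s : S), Ωe i = some s → σ i = s
  · simp only [if_pos hσ, sum_filter]
  · simp only [if_neg hσ, ite_self, sum_const_zero]

/-- The «respects» set splits over the sector of any leg: `Σ_{σ ⊒ Ωe} f σ = Σ_{s₀} Σ_{σ : σ t = s₀ ∧ σ ⊒ Ωe} f σ`. -/
theorem sum_respects_eq_sum_sum_fullPin {n : ℕ} {α : Type*} [AddCommMonoid α] (f : (Fin n → S) → α) (Ωe : Fin n → Option S) (t : Fin n) :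
    ∑ σ ∈ univ.filter (fun σ : Fin n → S => ∀ (i : Fin n) (s : S), Ωe i = some s → σ i = s), f σ =
      ∑ s₀ : S, ∑ σ ∈ univ.filter (fun σ : Fin n → S => σ t = s₀ ∧ ∀ (i : Fin n) (s : S), Ωe i = some s → σ i = s), f σ := by
  rw [← Finset.sum_fiberwise (univ.filter fun σ : Fin n → S => ∀ (i : Fin n) (s : S), Ωe i = some s → σ i = s) (fun σ => σ t) f]
  refine sum_congr rfl fun s₀ _ => sum_congr ?_ fun _ _ => rfl
  ext σ
  simp only [mem_filter, mem_univ, true_and]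
  tauto

/-- **Removing a prescribed leg**: if `Ωe q = some s_q` then `{σ ⊒ Ωe} = {σ : σ q = s_q ∧ σ ⊒ Ωe[q ↦ none]}`. -/
theorem respects_filter_eq_update {n : ℕ} (Ωe : Fin n → Option S) {q : Fin n} {sq : S} (hq : Ωe q = some sq) :
    univ.filter (fun σ : Fin n → S => ∀ (i : Fin n) (s : S), Ωe i = some s → σ i = s) =
      univ.filter (fun σ : Fin n → S => σ q = sq ∧ ∀ (i : Fin n) (s : S), Function.update Ωe q none i = some s → σ i = s) := by
  ext σ
  simp only [mem_filter, mem_univ, true_and]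
  constructor
  · intro h
    refine ⟨h q sq hq, fun i s his => ?_⟩
    by_cases hi : i = q
    · subst hi; rw [Function.update_self] at his; exact absurd his (by simp)
    · rw [Function.update_of_ne hi] at his; exact h i s his
  · rintro ⟨hσq, h⟩ i s his
    by_cases hi : i = q
    · subst hi; rw [hq] at his; rw [hσq]; exact (Option.some.inj his)
    · exact h i s (by rw [Function.update_of_ne hi]; exact his)

/-- **The level drops by one** when a prescribed leg is removed: `levelCount (Ωe[q ↦ none]) + 1 = levelCount Ωe` for `Ωe q = some _`. -/
theorem levelCount_update_none {n N : ℕ} (Ωe : Fin n → Option (SectorLeg N)) {q : Fin n} (hq : (Ωe q).isSome) :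
    levelCount (Function.update Ωe q none) + 1 = levelCount Ωe := by
  unfold levelCount
  have hmem : q ∈ univ.filter (fun i : Fin n => (Ωe i).isSome) := by simp [hq]
  rw [← card_erase_add_one hmem]
  congr 2
  ext i
  simp only [mem_filter, mem_univ, true_and, mem_erase]
  by_cases hi : i = q
  · subst hi; simp
  · simp [hi]

end Generic

/-! ## §2 MODEL, `(σ, x)` currency: the «respects» sums of a conserving polynomial against `klLevNormOf` -/

variable {L M : ℕ} [NeZero L] [NeZero M]

omit [NeZero M] in
/-- **FULL PIN, ANY LEG**: for a momentum-conserving `T` at the thin family `F_J`, every partial assignment `Ωe`, leg `t`, sector `s₀`, point `y`: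
`ε^m Σ_{σ : σ t = s₀, σ ⊒ Ωe} Σ_{x : x_t = y} ‖W^{F_J}_σ(T)(x)‖ ≤ klLevNormOf … J (m+1) T Ωe` (one term of the supremum; tuples outside BGM's sector set carry `0`). -/
theorem respects_fullPin_le_klLevNormOf {β : ℝ} (hβ : 0 ≤ β) (μ : ℝ) (K : TrigPolyC4v) (J : ℕ) (T : HubbardGrassmann L M)
    (hT : ∀ (m : ℕ) (X : Fin m → HubbardFieldIdx L M), ∑ i, signedMomentum L (X i).2 (X i).1.1.2 ≠ 0 → kernel ℂ T m X = 0)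
    {m : ℕ} (Ωe : Fin (m + 1) → Option (SectorLeg (sectorCount J))) (t : Fin (m + 1)) (s₀ : SectorLeg (sectorCount J)) (y : SpaceTimeIdx L M) :
    imagTimeWeight β M ^ m *
        ∑ σ ∈ univ.filter (fun σ : Fin (m + 1) → SectorLeg (sectorCount J) =>
            σ t = s₀ ∧ ∀ (i : Fin (m + 1)) (s : SectorLeg (sectorCount J)), Ωe i = some s → σ i = s),
          ∑ x ∈ univ.filter (fun x : Fin (m + 1) → SpaceTimeIdx L M => x t = y),
            ‖sectorisedKernel L M β (klAnisoFamily L M β μ K klE0 J) T (m + 1) σ x‖ ≤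
      klLevNormOf L M β μ K J (m + 1) T Ωe := by
  have hε0 : 0 ≤ imagTimeWeight β M := imagTimeWeight_nonneg hβ M
  set F := klAnisoFamily L M β μ K klE0 J with hF
  rw [klLevNormOf, hubbardSectorKernelNorm_def]
  refine le_trans ?_ (sectorLegSum_le_sectorisedKernelNorm (imagTimeWeight β M) _ _ t s₀ y)
  rw [sectorLegSum_def, ← mul_sum]
  refine mul_le_mul_of_nonneg_left ?_ (pow_nonneg hε0 m)
  have hsub : (prescribedTuples (bgmSectorSet L M F (m + 1)) Ωe).filter (fun σ : Fin (m + 1) → SectorLeg (sectorCount J) => σ t = s₀) ⊆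
      univ.filter (fun σ : Fin (m + 1) → SectorLeg (sectorCount J) =>
        σ t = s₀ ∧ ∀ (i : Fin (m + 1)) (s : SectorLeg (sectorCount J)), Ωe i = some s → σ i = s) := by
    intro σ hσ
    simp only [mem_filter, prescribedTuples, mem_univ, true_and] at hσ ⊢
    exact ⟨hσ.2, fun i s his => hσ.1.2 i s (Option.mem_def.2 his)⟩
  rw [← Finset.sum_subset hsub fun σ hσuniv hσnot => ?_]
  have hP := (mem_filter.1 hσuniv).2
  have hnot : σ ∉ bgmSectorSet L M F (m + 1) := by
    intro h
    refine hσnot (mem_filter.2 ⟨?_, hP.1⟩)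
    simp only [prescribedTuples, mem_filter]
    exact ⟨h, fun i s hs => hP.2 i s (Option.mem_def.1 hs)⟩
  exact sum_eq_zero fun x _ => by rw [sectorisedKernel_eq_zero_of_not_mem_bgmSectorSet β F T hT hnot x, norm_zero]

/-- **POSITION-ONLY PIN, ANY LEG, ONE LEVEL LOWER**: for a frequency– and momentum-conserving `T` (`0 < β`), if the leg `q` is prescribed (`Ωe q = some s_q`), then for
EVERY leg `t` and point `y`: `ε^m Σ_{σ ⊒ Ωe} Σ_{x : x_t = y} ‖W^{F_J}_σ(T)(x)‖ ≤ klLevNormOf … J (m+1) T (Ωe[q ↦ none])` — translation invariance moves the position pin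
from `t` onto the prescribed leg `q`, which then serves as the norm's pinned leg. [cite: BenfattoGiulianiMastropietro2006, App. A4 (A4.8)] -/
theorem respects_posPin_le_klLevNormOf_update {β : ℝ} (hβ : 0 < β) (μ : ℝ) (K : TrigPolyC4v) (J : ℕ) (T : HubbardGrassmann L M)
    (hTf : ∀ (m : ℕ) (X : Fin m → HubbardFieldIdx L M),
      (∑ i, (if (X i).2 = 0 then (1 : ℤ) else -1) * matsubaraInt M (X i).1.1.1) ≠ 0 → kernel ℂ T m X = 0)
    (hT : ∀ (m : ℕ) (X : Fin m → HubbardFieldIdx L M), ∑ i, signedMomentum L (X i).2 (X i).1.1.2 ≠ 0 → kernel ℂ T m X = 0)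
    {m : ℕ} (Ωe : Fin (m + 1) → Option (SectorLeg (sectorCount J))) {q : Fin (m + 1)} {sq : SectorLeg (sectorCount J)} (hq : Ωe q = some sq)
    (t : Fin (m + 1)) (y : SpaceTimeIdx L M) :
    imagTimeWeight β M ^ m *
        ∑ σ ∈ univ.filter (fun σ : Fin (m + 1) → SectorLeg (sectorCount J) =>
            ∀ (i : Fin (m + 1)) (s : SectorLeg (sectorCount J)), Ωe i = some s → σ i = s),
          ∑ x ∈ univ.filter (fun x : Fin (m + 1) → SpaceTimeIdx L M => x t = y),
            ‖sectorisedKernel L M β (klAnisoFamily L M β μ K klE0 J) T (m + 1) σ x‖ ≤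
      klLevNormOf L M β μ K J (m + 1) T (Function.update Ωe q none) := by
  haveI : NeZero (2 * M) := ⟨by have := NeZero.ne M; omega⟩
  have htr : ∀ (σ : Fin (m + 1) → SectorLeg (sectorCount J)) (x : Fin (m + 1) → SpaceTimeIdx L M) (a : SpaceTimeIdx L M),
      ‖sectorisedKernel L M β (klAnisoFamily L M β μ K klE0 J) T (m + 1) σ (fun i => x i + a)‖ =
        ‖sectorisedKernel L M β (klAnisoFamily L M β μ K klE0 J) T (m + 1) σ x‖ :=
    fun σ x a => norm_sectorisedKernel_translate hβ.ne' _ T hTf hT (m + 1) σ x a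
  rw [sum_congr rfl fun σ _ => sum_filter_apply_eq_of_translate (fun x => ‖sectorisedKernel L M β (klAnisoFamily L M β μ K klE0 J) T (m + 1) σ x‖)
    (htr σ) t q y y, respects_filter_eq_update Ωe hq]
  exact respects_fullPin_le_klLevNormOf hβ.le μ K J T hT (Function.update Ωe q none) q sq y

omit [NeZero M] in
/-- **POSITION-ONLY PIN, CRUDE (any `Ωe`)**: `ε^m Σ_{σ ⊒ Ωe} Σ_{x_t = y} ‖W^{F_J}_σ(T)(x)‖ ≤ |SectorLeg (sectorCount J)| · klLevNormOf … Ωe` (split over the pinned leg's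
sector; each full pin is one term of the supremum).  Serves the swapped slot where no prescribed leg is available. -/
theorem respects_posPin_le_card_mul_klLevNormOf {β : ℝ} (hβ : 0 ≤ β) (μ : ℝ) (K : TrigPolyC4v) (J : ℕ) (T : HubbardGrassmann L M)
    (hT : ∀ (m : ℕ) (X : Fin m → HubbardFieldIdx L M), ∑ i, signedMomentum L (X i).2 (X i).1.1.2 ≠ 0 → kernel ℂ T m X = 0)
    {m : ℕ} (Ωe : Fin (m + 1) → Option (SectorLeg (sectorCount J))) (t : Fin (m + 1)) (y : SpaceTimeIdx L M) :
    imagTimeWeight β M ^ m *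
        ∑ σ ∈ univ.filter (fun σ : Fin (m + 1) → SectorLeg (sectorCount J) =>
            ∀ (i : Fin (m + 1)) (s : SectorLeg (sectorCount J)), Ωe i = some s → σ i = s),
          ∑ x ∈ univ.filter (fun x : Fin (m + 1) → SpaceTimeIdx L M => x t = y),
            ‖sectorisedKernel L M β (klAnisoFamily L M β μ K klE0 J) T (m + 1) σ x‖ ≤
      Fintype.card (SectorLeg (sectorCount J)) * klLevNormOf L M β μ K J (m + 1) T Ωe := by
  rw [sum_respects_eq_sum_sum_fullPin _ Ωe t, mul_sum]
  calc ∑ s₀ : SectorLeg (sectorCount J), imagTimeWeight β M ^ m *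
        ∑ σ ∈ univ.filter (fun σ : Fin (m + 1) → SectorLeg (sectorCount J) =>
            σ t = s₀ ∧ ∀ (i : Fin (m + 1)) (s : SectorLeg (sectorCount J)), Ωe i = some s → σ i = s),
          ∑ x ∈ univ.filter (fun x : Fin (m + 1) → SpaceTimeIdx L M => x t = y),
            ‖sectorisedKernel L M β (klAnisoFamily L M β μ K klE0 J) T (m + 1) σ x‖
      ≤ ∑ _s₀ : SectorLeg (sectorCount J), klLevNormOf L M β μ K J (m + 1) T Ωe :=
        sum_le_sum fun s₀ _ => respects_fullPin_le_klLevNormOf hβ μ K J T hT Ωe t s₀ y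
    _ = Fintype.card (SectorLeg (sectorCount J)) * klLevNormOf L M β μ K J (m + 1) T Ωe := by rw [sum_const, card_univ, nsmul_eq_mul]

/-! ### Tower instances: the block input `𝒱_{dk}` at `F_{dk−1}` -/

/-- **Full pin ⇒ the measured level `levelCount Ωe`**: `ε^m Σ_{σ : σ t = s₀, σ ⊒ Ωe} Σ_{x_t = y} ‖W^{F_{dk−1}}_σ(𝒱_{dk})(x)‖ ≤ klTowerMeasLev … d k (m+1) (levelCount Ωe)`. -/
theorem respects_fullPin_klTowerInput_le_klTowerMeasLev {β : ℝ} (hβ : 0 ≤ β) (U μ : ℝ) (K : TrigPolyC4v) (d k : ℕ) {m : ℕ}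
    (Ωe : Fin (m + 1) → Option (SectorLeg (sectorCount (d * k - 1)))) (t : Fin (m + 1)) (s₀ : SectorLeg (sectorCount (d * k - 1)))
    (y : SpaceTimeIdx L M) :
    imagTimeWeight β M ^ m *
        ∑ σ ∈ univ.filter (fun σ : Fin (m + 1) → SectorLeg (sectorCount (d * k - 1)) =>
            σ t = s₀ ∧ ∀ (i : Fin (m + 1)) (s : SectorLeg (sectorCount (d * k - 1))), Ωe i = some s → σ i = s),
          ∑ x ∈ univ.filter (fun x : Fin (m + 1) → SpaceTimeIdx L M => x t = y),
            ‖sectorisedKernel L M β (klAnisoFamily L M β μ K klE0 (d * k - 1)) (klTowerInput L M β U μ K d k) (m + 1) σ x‖ ≤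
      klTowerMeasLev L M β U μ K d k (m + 1) (levelCount Ωe) :=
  (respects_fullPin_le_klLevNormOf hβ μ K (d * k - 1) (klTowerInput L M β U μ K d k)
    (fun m' X hX => klEffectiveAction_momentumConserving β U μ K klE0 (d * k) m' X hX) Ωe t s₀ y).trans
    (klLevNormOf_le_klTowerMeasLev β U μ K d k (m + 1) Ωe)

/-- **Position-only pin, one prescribed leg removed ⇒ the measured level `levelCount Ωe − 1`** (`0 < β`, `Ωe q = some _`, ANY `t`). -/
theorem respects_posPin_klTowerInput_le_klTowerMeasLev {β : ℝ} (hβ : 0 < β) (U μ : ℝ) (K : TrigPolyC4v) (d k : ℕ) {m : ℕ}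
    (Ωe : Fin (m + 1) → Option (SectorLeg (sectorCount (d * k - 1)))) {q : Fin (m + 1)} {sq : SectorLeg (sectorCount (d * k - 1))}
    (hq : Ωe q = some sq) (t : Fin (m + 1)) (y : SpaceTimeIdx L M) :
    imagTimeWeight β M ^ m *
        ∑ σ ∈ univ.filter (fun σ : Fin (m + 1) → SectorLeg (sectorCount (d * k - 1)) =>
            ∀ (i : Fin (m + 1)) (s : SectorLeg (sectorCount (d * k - 1))), Ωe i = some s → σ i = s),
          ∑ x ∈ univ.filter (fun x : Fin (m + 1) → SpaceTimeIdx L M => x t = y),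
            ‖sectorisedKernel L M β (klAnisoFamily L M β μ K klE0 (d * k - 1)) (klTowerInput L M β U μ K d k) (m + 1) σ x‖ ≤
      klTowerMeasLev L M β U μ K d k (m + 1) (levelCount Ωe - 1) := by
  have hlev : levelCount (Function.update Ωe q none) = levelCount Ωe - 1 := by
    have h := levelCount_update_none Ωe (q := q) (by rw [hq]; rfl)
    omega
  refine (respects_posPin_le_klLevNormOf_update hβ μ K (d * k - 1) (klTowerInput L M β U μ K d k)
    (fun m' X hX => kernel_klEffectiveAction_eq_zero_of_freq β U μ K klE0 (d * k) hX)
    (fun m' X hX => klEffectiveAction_momentumConserving β U μ K klE0 (d * k) m' X hX) Ωe hq t y).trans ?_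
  rw [← hlev]
  exact klLevNormOf_le_klTowerMeasLev β U μ K d k (m + 1) _

/-- **Position-only pin, crude ⇒ `|Sec|` times the measured level `levelCount Ωe`** (any `Ωe`, any `t`). -/
theorem respects_posPin_klTowerInput_le_card_mul_klTowerMeasLev {β : ℝ} (hβ : 0 ≤ β) (U μ : ℝ) (K : TrigPolyC4v) (d k : ℕ) {m : ℕ}
    (Ωe : Fin (m + 1) → Option (SectorLeg (sectorCount (d * k - 1)))) (t : Fin (m + 1)) (y : SpaceTimeIdx L M) :
    imagTimeWeight β M ^ m *
        ∑ σ ∈ univ.filter (fun σ : Fin (m + 1) → SectorLeg (sectorCount (d * k - 1)) =>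
            ∀ (i : Fin (m + 1)) (s : SectorLeg (sectorCount (d * k - 1))), Ωe i = some s → σ i = s),
          ∑ x ∈ univ.filter (fun x : Fin (m + 1) → SpaceTimeIdx L M => x t = y),
            ‖sectorisedKernel L M β (klAnisoFamily L M β μ K klE0 (d * k - 1)) (klTowerInput L M β U μ K d k) (m + 1) σ x‖ ≤
      Fintype.card (SectorLeg (sectorCount (d * k - 1))) * klTowerMeasLev L M β U μ K d k (m + 1) (levelCount Ωe) :=
  (respects_posPin_le_card_mul_klLevNormOf hβ μ K (d * k - 1) (klTowerInput L M β U μ K d k)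
    (fun m' X hX => klEffectiveAction_momentumConserving β U μ K klE0 (d * k) m' X hX) Ωe t y).trans
    (mul_le_mul_of_nonneg_left (klLevNormOf_le_klTowerMeasLev β U μ K d k (m + 1) Ωe) (Nat.cast_nonneg _))

/-! ## §3 MODEL, `Γ`-tuple currency: the literal layer-1 `hN` / `hNsw` shapes over `K = kernel (sectorPreimage β F_{dk−1} 𝒱_{dk}) (m+1)` -/

omit [NeZero M] in
/-- The kernel of the sector preimage in the `(σ, x)` currency, with the «respects» guard: for `K = kernel (sectorPreimage β F G) (m+1)`,
`Σ_{Y : Y t = a} (if Y ⊒ Ωe then ‖K Y‖ else 0) = ε_x·(ε_x^m Σ_{σ : σ t = a.2, σ ⊒ Ωe} Σ_{x_t = a.1} ‖W_{F,σ}(x)‖)` (`0 ≤ β`). -/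
theorem sum_ite_respects_kernel_sectorPreimage_eq {N : ℕ} {β : ℝ} (hβ : 0 ≤ β) (F : Fin N → FreqMomentum L M → ℂ) (G : HubbardGrassmann L M) (m : ℕ)
    (Ωe : Fin (m + 1) → Option (SectorLeg N)) (t : Fin (m + 1)) (a : SpaceTimeIdx L M × SectorLeg N) :
    ∑ Y ∈ univ.filter (fun Y : Fin (m + 1) → SpaceTimeIdx L M × SectorLeg N => Y t = a),
        (if ∀ (i : Fin (m + 1)) (s : SectorLeg N), Ωe i = some s → (Y i).2 = s then ‖kernel ℂ (sectorPreimage β F G) (m + 1) Y‖ else 0) =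
      imagTimeWeight β M * (imagTimeWeight β M ^ m *
        ∑ σ ∈ univ.filter (fun σ : Fin (m + 1) → SectorLeg N => σ t = a.2 ∧ ∀ (i : Fin (m + 1)) (s : SectorLeg N), Ωe i = some s → σ i = s),
          ∑ x ∈ univ.filter (fun x : Fin (m + 1) → SpaceTimeIdx L M => x t = a.1), ‖sectorisedKernel L M β F G (m + 1) σ x‖) := by
  have hε : 0 ≤ imagTimeWeight β M := imagTimeWeight_nonneg hβ M
  have hK : ∀ Y : Fin (m + 1) → SpaceTimeIdx L M × SectorLeg N, ‖kernel ℂ (sectorPreimage β F G) (m + 1) Y‖ =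
      imagTimeWeight β M ^ (m + 1) * ‖sectorisedKernel L M β F G (m + 1) (fun i => (Y i).2) (fun i => (Y i).1)‖ := by
    intro Y
    rw [kernel_sectorPreimage_eq_sectorisedKernel β F G (m + 1) Y, norm_mul, norm_pow, Complex.norm_real, Real.norm_of_nonneg hε]
  simp_rw [hK]
  rw [sum_ite_respects_fullPin_eq (fun σ x => imagTimeWeight β M ^ (m + 1) * ‖sectorisedKernel L M β F G (m + 1) σ x‖) Ωe t a]
  rw [← mul_assoc, ← pow_succ', mul_sum]
  exact sum_congr rfl fun σ _ => by rw [mul_sum]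

/-- **`hN` AT THE MODEL VERTEX, `ρ′` currency** (full pin, any leg `t`, any `a`): for `K = kernel (sectorPreimage β F_{dk−1} 𝒱_{dk}[K]) (m+1)`,
`Σ_{Y : Y t = a} (if Y ⊒ Ωe then ‖K Y‖ else 0) ≤ ε_x · klTowerMeasLev L M β U μ K d k (m+1) (levelCount Ωe)` (`0 ≤ β`).
[cite: BenfattoGiulianiMastropietro2006, §2.8 (2.97)-(2.98)] -/
theorem hN_respects_klTowerInput {β : ℝ} (hβ : 0 ≤ β) (U μ : ℝ) (K : TrigPolyC4v) (d k : ℕ) {m : ℕ}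
    (Ωe : Fin (m + 1) → Option (SectorLeg (sectorCount (d * k - 1)))) (t : Fin (m + 1))
    (a : SpaceTimeIdx L M × SectorLeg (sectorCount (d * k - 1))) :
    ∑ Y ∈ univ.filter (fun Y : Fin (m + 1) → SpaceTimeIdx L M × SectorLeg (sectorCount (d * k - 1)) => Y t = a),
        (if ∀ (i : Fin (m + 1)) (s : SectorLeg (sectorCount (d * k - 1))), Ωe i = some s → (Y i).2 = s then
          ‖kernel ℂ (sectorPreimage β (klAnisoFamily L M β μ K klE0 (d * k - 1)) (klTowerInput L M β U μ K d k)) (m + 1) Y‖ else 0) ≤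
      imagTimeWeight β M * klTowerMeasLev L M β U μ K d k (m + 1) (levelCount Ωe) := by
  rw [sum_ite_respects_kernel_sectorPreimage_eq hβ]
  exact mul_le_mul_of_nonneg_left (respects_fullPin_klTowerInput_le_klTowerMeasLev hβ U μ K d k Ωe t a.2 a.1) (imagTimeWeight_nonneg hβ M)

/-- **`hNsw` AT THE MODEL VERTEX, `ρ′` currency, ONE LEVEL LOWER**: for `0 < β`, a prescribed leg `Ωe q = some _`, ANY leg `t`: there is `g ≥ 0` on the sector
labels with `Σ_{Y : Y t = a} (if Y ⊒ Ωe then ‖K Y‖ else 0) ≤ g a.2` for every `a` and `Σ_{σ₀} g σ₀ ≤ ε_x · klTowerMeasLev L M β U μ K d k (m+1) (levelCount Ωe − 1)`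
(`g σ₀ :=` the full-pin sum at `(0, σ₀)`; translation invariance). [cite: BenfattoGiulianiMastropietro2006, App. A4 (A4.8)] -/
theorem hNsw_respects_klTowerInput {β : ℝ} (hβ : 0 < β) (U μ : ℝ) (K : TrigPolyC4v) (d k : ℕ) {m : ℕ}
    (Ωe : Fin (m + 1) → Option (SectorLeg (sectorCount (d * k - 1)))) {q : Fin (m + 1)} {sq : SectorLeg (sectorCount (d * k - 1))}
    (hq : Ωe q = some sq) (t : Fin (m + 1)) :
    ∃ g : SectorLeg (sectorCount (d * k - 1)) → ℝ, (∀ σ₀, 0 ≤ g σ₀) ∧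
      (∀ a : SpaceTimeIdx L M × SectorLeg (sectorCount (d * k - 1)),
        ∑ Y ∈ univ.filter (fun Y : Fin (m + 1) → SpaceTimeIdx L M × SectorLeg (sectorCount (d * k - 1)) => Y t = a),
          (if ∀ (i : Fin (m + 1)) (s : SectorLeg (sectorCount (d * k - 1))), Ωe i = some s → (Y i).2 = s then
            ‖kernel ℂ (sectorPreimage β (klAnisoFamily L M β μ K klE0 (d * k - 1)) (klTowerInput L M β U μ K d k)) (m + 1) Y‖ else 0) ≤ g a.2) ∧
      ∑ σ₀, g σ₀ ≤ imagTimeWeight β M * klTowerMeasLev L M β U μ K d k (m + 1) (levelCount Ωe - 1) := by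
  haveI : NeZero (2 * M) := ⟨by have := NeZero.ne M; omega⟩
  have hε : 0 ≤ imagTimeWeight β M := imagTimeWeight_nonneg hβ.le M
  set F := klAnisoFamily L M β μ K klE0 (d * k - 1) with hF
  set T := klTowerInput L M β U μ K d k with hT
  -- the `(σ, x)`-currency full-pin sum at sector `s₀`, point `y`
  set S : SectorLeg (sectorCount (d * k - 1)) → SpaceTimeIdx L M → ℝ := fun s₀ y =>
    imagTimeWeight β M ^ m *
      ∑ σ ∈ univ.filter (fun σ : Fin (m + 1) → SectorLeg (sectorCount (d * k - 1)) =>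
          σ t = s₀ ∧ ∀ (i : Fin (m + 1)) (s : SectorLeg (sectorCount (d * k - 1))), Ωe i = some s → σ i = s),
        ∑ x ∈ univ.filter (fun x : Fin (m + 1) → SpaceTimeIdx L M => x t = y), ‖sectorisedKernel L M β F T (m + 1) σ x‖ with hS
  have htr : ∀ (σ : Fin (m + 1) → SectorLeg (sectorCount (d * k - 1))) (x : Fin (m + 1) → SpaceTimeIdx L M) (a : SpaceTimeIdx L M),
      ‖sectorisedKernel L M β F T (m + 1) σ (fun i => x i + a)‖ = ‖sectorisedKernel L M β F T (m + 1) σ x‖ :=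
    fun σ x a => norm_sectorisedKernel_klTowerInput_translate hβ.ne' F U μ K d k (m + 1) σ x a
  have hSy : ∀ s₀ y y', S s₀ y = S s₀ y' := by
    intro s₀ y y'
    simp only [hS]
    congr 1
    exact sum_congr rfl fun σ _ => sum_filter_apply_eq_of_translate (fun x => ‖sectorisedKernel L M β F T (m + 1) σ x‖) (htr σ) t t y y'
  refine ⟨fun s₀ => imagTimeWeight β M * S s₀ 0, fun s₀ => ?_, fun a => ?_, ?_⟩
  · exact mul_nonneg hε (mul_nonneg (pow_nonneg hε m) (sum_nonneg fun _ _ => sum_nonneg fun _ _ => norm_nonneg _))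
  · rw [sum_ite_respects_kernel_sectorPreimage_eq hβ.le]
    change imagTimeWeight β M * S a.2 a.1 ≤ imagTimeWeight β M * S a.2 0
    rw [hSy a.2 a.1 0]
  · rw [← mul_sum]
    refine mul_le_mul_of_nonneg_left ?_ hε
    have hsplit := sum_respects_eq_sum_sum_fullPin
      (fun σ => ∑ x ∈ univ.filter (fun x : Fin (m + 1) → SpaceTimeIdx L M => x t = 0), ‖sectorisedKernel L M β F T (m + 1) σ x‖) Ωe t
    have hpos := respects_posPin_klTowerInput_le_klTowerMeasLev hβ U μ K d k Ωe hq t (0 : SpaceTimeIdx L M)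
    rw [← hF, ← hT, hsplit, mul_sum] at hpos
    exact hpos

/-- **`hNsw` AT THE MODEL VERTEX, `ρ′` currency, CRUDE (any `Ωe`)**: `∃ g ≥ 0`, full pins `≤ g a.2`, `Σ_{σ₀} g σ₀ ≤ |SectorLeg (sectorCount (dk−1))| · ε_x ·
klTowerMeasLev L M β U μ K d k (m+1) (levelCount Ωe)` (`0 < β`; the slot for a vertex with no prescribed leg). [cite: BenfattoGiulianiMastropietro2006, App. A4 (A4.8)] -/
theorem hNsw_respects_klTowerInput_card {β : ℝ} (hβ : 0 < β) (U μ : ℝ) (K : TrigPolyC4v) (d k : ℕ) {m : ℕ}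
    (Ωe : Fin (m + 1) → Option (SectorLeg (sectorCount (d * k - 1)))) (t : Fin (m + 1)) :
    ∃ g : SectorLeg (sectorCount (d * k - 1)) → ℝ, (∀ σ₀, 0 ≤ g σ₀) ∧
      (∀ a : SpaceTimeIdx L M × SectorLeg (sectorCount (d * k - 1)),
        ∑ Y ∈ univ.filter (fun Y : Fin (m + 1) → SpaceTimeIdx L M × SectorLeg (sectorCount (d * k - 1)) => Y t = a),
          (if ∀ (i : Fin (m + 1)) (s : SectorLeg (sectorCount (d * k - 1))), Ωe i = some s → (Y i).2 = s then
            ‖kernel ℂ (sectorPreimage β (klAnisoFamily L M β μ K klE0 (d * k - 1)) (klTowerInput L M β U μ K d k)) (m + 1) Y‖ else 0) ≤ g a.2) ∧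
      ∑ σ₀, g σ₀ ≤ Fintype.card (SectorLeg (sectorCount (d * k - 1))) * (imagTimeWeight β M * klTowerMeasLev L M β U μ K d k (m + 1) (levelCount Ωe)) := by
  haveI : NeZero (2 * M) := ⟨by have := NeZero.ne M; omega⟩
  have hε : 0 ≤ imagTimeWeight β M := imagTimeWeight_nonneg hβ.le M
  set F := klAnisoFamily L M β μ K klE0 (d * k - 1) with hF
  set T := klTowerInput L M β U μ K d k with hT
  set S : SectorLeg (sectorCount (d * k - 1)) → SpaceTimeIdx L M → ℝ := fun s₀ y =>
    imagTimeWeight β M ^ m *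
      ∑ σ ∈ univ.filter (fun σ : Fin (m + 1) → SectorLeg (sectorCount (d * k - 1)) =>
          σ t = s₀ ∧ ∀ (i : Fin (m + 1)) (s : SectorLeg (sectorCount (d * k - 1))), Ωe i = some s → σ i = s),
        ∑ x ∈ univ.filter (fun x : Fin (m + 1) → SpaceTimeIdx L M => x t = y), ‖sectorisedKernel L M β F T (m + 1) σ x‖ with hS
  have htr : ∀ (σ : Fin (m + 1) → SectorLeg (sectorCount (d * k - 1))) (x : Fin (m + 1) → SpaceTimeIdx L M) (a : SpaceTimeIdx L M),
      ‖sectorisedKernel L M β F T (m + 1) σ (fun i => x i + a)‖ = ‖sectorisedKernel L M β F T (m + 1) σ x‖ :=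
    fun σ x a => norm_sectorisedKernel_klTowerInput_translate hβ.ne' F U μ K d k (m + 1) σ x a
  have hSy : ∀ s₀ y y', S s₀ y = S s₀ y' := by
    intro s₀ y y'
    simp only [hS]
    congr 1
    exact sum_congr rfl fun σ _ => sum_filter_apply_eq_of_translate (fun x => ‖sectorisedKernel L M β F T (m + 1) σ x‖) (htr σ) t t y y'
  refine ⟨fun s₀ => imagTimeWeight β M * S s₀ 0, fun s₀ => ?_, fun a => ?_, ?_⟩
  · exact mul_nonneg hε (mul_nonneg (pow_nonneg hε m) (sum_nonneg fun _ _ => sum_nonneg fun _ _ => norm_nonneg _))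
  · rw [sum_ite_respects_kernel_sectorPreimage_eq hβ.le]
    change imagTimeWeight β M * S a.2 a.1 ≤ imagTimeWeight β M * S a.2 0
    rw [hSy a.2 a.1 0]
  · calc ∑ s₀, imagTimeWeight β M * S s₀ 0 ≤ ∑ _s₀ : SectorLeg (sectorCount (d * k - 1)), imagTimeWeight β M * klTowerMeasLev L M β U μ K d k (m + 1) (levelCount Ωe) :=
          sum_le_sum fun s₀ _ => mul_le_mul_of_nonneg_left (respects_fullPin_klTowerInput_le_klTowerMeasLev hβ.le U μ K d k Ωe t s₀ 0) hε
      _ = Fintype.card (SectorLeg (sectorCount (d * k - 1))) * (imagTimeWeight β M * klTowerMeasLev L M β U μ K d k (m + 1) (levelCount Ωe)) := by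
          rw [sum_const, card_univ, nsmul_eq_mul]

end Summit.HubbardSuperconductivity.HubbardSuperconductivity.Theorems.EngineV8
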